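import Summits.KontsevichZagierPeriods.Zeta5Search.Certificates.RecordRayDenominatorsBricksClassK
import Summits.KontsevichZagierPeriods.Zeta5Search.RecordLettersKitM2T
import Summits.KontsevichZagierPeriods.Zeta5Search.RecordLettersKitM2U
import Summits.KontsevichZagierPeriods.Zeta5Search.RecordLettersKitM2S
import HarnessLib

/-!
# ζ(5) search — the record ray's DENOMINATORS, XI-e (F16, part N4): CLASS-LAW WINDOWS by name — the faces landed after stage D16 (p3 g7)

HONEST FRAMING: systematic search; no irrationality claim unless certified.

OUR work (Summit side; prover seat p3, generation 7).  The list `cwinsF16N4` of 5 class-law windows `⟨a₁, a₂, b₁, b₂, N₀, B⟩`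
(`θ = p/n ∈ (a₁/a₂, b₁/b₂)`, `n ≥ N₀`, Casoratian bound `B ≤ v_p(Cas₇(b(n)))`) and `cwinsF16N4_holds : ∀ c ∈ cwinsF16N4, c.Holds` — one
tree theorem `RecordLetters.<Tag>.window` per entry: p3 g6's `omega`-typed faces that landed after the D16 table was cut (tags H…),
and p3 g7's RAY FACE KIT faces `RecordLettersKitM2*` (tags M2F…: the census g37 letters windows at shift m = 2, θ ∈ (1/3, 1/2),
certificates checked by `decide +kernel` through P1 g14's `RayFaceKit` / `RecordRayFaceKit.rec_cover`).  Appended to the D16 lists in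
`RecordRayClassWindowsF16`; consumed by the kind-3/4/5 rows of the tables of files XII (F16) through `RecordRayDenominatorsBricksClassK`.
Valuations of rationals; every `γ < 1` — no irrationality content.
-/

noncomputable section

namespace Summit.KontsevichZagierPeriods.Zeta5Search.RecordRay

/-- Class-law windows (face tag (θ-range) bound): M2F171 (28/83,27/80) -298; M2F172 (29/86,28/83) -298; M2F173 (30/89,29/86) -298; M2F174 (41/122,30/89) -298; M2F163 (1/3,41/122) -298. -/
def cwinsF16N4 : List CWin :=
  [⟨28, 83, 27, 80, 256, -298⟩,
   ⟨29, 86, 28, 83, 256, -298⟩,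
   ⟨30, 89, 29, 86, 512, -298⟩,
   ⟨41, 122, 30, 89, 32, -298⟩,
   ⟨1, 3, 41, 122, 256, -298⟩]

/-- **Every window of the list holds** (the `RecordLetters*.window` theorems). -/
theorem cwinsF16N4_holds : ∀ c ∈ cwinsF16N4, c.Holds := by
  unfold cwinsF16N4
  exact List.forall_mem_cons.2 ⟨RecordLetters.M2F171.window, List.forall_mem_cons.2 ⟨RecordLetters.M2F172.window, List.forall_mem_cons.2 ⟨RecordLetters.M2F173.window, List.forall_mem_cons.2 ⟨RecordLetters.M2F174.window, List.forall_mem_cons.2 ⟨RecordLetters.M2F163.window, List.forall_mem_nil _⟩⟩⟩⟩⟩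

end Summit.KontsevichZagierPeriods.Zeta5Search.RecordRay
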